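import Summits.HodgeConjecture.HodgeConjecture.Theorems.Ring2AbelianAllWeilCellsInhabited
import Summits.HodgeConjecture.HodgeConjecture.Theorems.Ring2AbelianAllNonsplitNormObstruction
import Literature.AlgebraicGeometry.VanGeemen1994.WeilDiscriminantOfHyperbolic
import HarnessLib

/-!
# NSC(−2) · the MEMBER file (P2-NSC-1 (i), prover 2 gen 33): the CM-tower member of the Weil component
# `(n, d, δ) = (3, 3, [−2])` — a polarized `ℚ(√−3)`-Weil sixfold of discriminant class `[−2]` carrying a non-zero
# rational `(3,3)` Weil class, NOT hyperbolic for its polarization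

Family `hodge`, b2b cell `hweil`, NSC programme (cell target NSC(−2) = `Ring2.Hypotheses.WeilClassesComponent 3 3 [−2]`,
packet `run/shared/lean/b2b/hodge-weil/LADDER.md ## CARVER v131` C803 (a)/(d)). Helper of item stmt-HodgeConjecture-2524; an
`Nsc` file in the sense of the cell's import ruling (it imports ring-2 modules `Ring2AbelianAll*`, all fact-free and proved).

WHAT IS PROVED (0 sorry, def-free). Write `[−2] := QuotientGroup.mk (Units.mk0 (-2 : ℚ) _) : weilNormResidueGroup 3`
(the spelling of ring-2's `NonsplitNormObstruction.negTwo_ne_splitDiscriminantClass`), `h_K := 3·e^*a + φ^*e^*a`.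
* `nsc_minusTwo_weilSign` — `sign [−2] = (−1)³`: the component `(3, 3, [−2])` has the right sign (van Geemen 5.2 (4)).
* `nsc_minusTwo_member` — THE MEMBER: there is a complex abelian sixfold `(A, φ)`, `φ ≫ φ = −3`, with a projective embedding
  `e` and a rational `a ≠ 0` such that `h_K` has NON-DEGENERATE discriminant class `[−2]`, together with a non-zero rational
  Weil class of Hodge type `(3,3)`. It is ring-2's CM TOWER `Ring2.AbelianAll.exists_member` /
  `weilClassesComponent_inhabited_of_weilSign_eq` at `(3, 3, [−2])`; unwinding that induction, the witness the proof term builds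
  is `P₀ = (E₀ × E₀) × (E₀ × E₀) × (E₀ × E₀)`, `E₀` the CM elliptic curve with `ψ₀ ≫ ψ₀ = −3`
  (`CMEndomorphism.exists_cmCurve_sqrt_neg 3`), `φ = (ψ₀ × (−ψ₀))³`, Segre-polarized with weights `(m₁,…,m₆) = (2,1,1,1,1,1)`
  (`exists_mk_neg_natCast_mul_eq`: `[−2] = [−(2·1)]`, then twice `× (1, [−1·1])`), so that `det H = [−2·1]·[−1]·[−1] = [−2]` — the
  ANCHOR `P₀ = (E × Ē)³`, `m = (2,1,1,1,1,1)` of C803 (a).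
* `nsc_minusTwo_member_weilType` — the same member in the embedded form of `exists_member` (Weil type `(3,3)`, `h_K⁶ ≠ 0`).
* `nsc_minusTwo_not_isHyperbolicWeilType` — NO polarized member of class `[−2]` is hyperbolic for its `h_K`
  (`[−2] ≠ [(−1)³]` because `2 ∉ Nm(ℚ(√−3)ˣ)`, ring-2's `negTwo_ne_splitDiscriminantClass`, and van Geemen (5.4.1) ⟹ on the carriers,
  `VanGeemen1994.not_isHyperbolicWeilType_of_hasWeilDiscriminantNondeg_ne`): the component is of NON-SPLIT type.
* `nsc_minusTwo_member_not_isHyperbolicWeilType` — the member together with its non-hyperbolicity.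

HONEST FRAMING: bookkeeping on the carriers (one-line specialisations of ring-2 / Literature theorems); the value is the typed
object. Nothing here is a rung or a case of the Hodge conjecture; `HC_CM` occurs nowhere; no statement of [Markman 2025] (arXiv:2502.03415,
unrefereed) is used. [cite: vanGeemen1994HodgeAV, 4.11, 4.14, Lemma 5.2 and (5.4.1)] [cite: Deligne1982HodgeCycles, proof of Thm. 4.8]
-/

noncomputable section

-- mandated namespace `Summit.HodgeConjecture.HodgeConjecture.…` (Problem = Summit) trips `linter.dupNamespace`; the lakefile disables it
-- tree-wide (weak option), restated here so stand-alone elaboration is warning-free too.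
set_option linter.dupNamespace false

open CategoryTheory
open Literature.AlgebraicGeometry Literature.AlgebraicGeometry.Motives
open Literature.AlgebraicGeometry.HodgeTheory
open Literature.AlgebraicGeometry.VanGeemen1994
open Literature.AlgebraicTopology.SingularHomology
open Literature.Geometry.Kaehler (lefschetzPow)
open Summit.HodgeConjecture.HodgeConjecture.Ring2.Hypotheses
open Summit.HodgeConjecture.HodgeConjecture.Ring2.AbelianAll
open Summit.HodgeConjecture.Ring2AbelianAll.NonsplitNormObstruction (negTwo_ne_splitDiscriminantClass)

namespace Summit.HodgeConjecture.HodgeConjecture.WeilTypeLadder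

section NscMemberMinusTwo

/-- **`sign [−2] = (−1)³`**: the discriminant class `[−2] ∈ ℚˣ/Nm(ℚ(√−3)ˣ)` has the sign of a sixfold component (`n = 3`), so the
component `(3, 3, [−2])` is realisable (van Geemen 4.14, Lemma 5.2 (4)). [cite: vanGeemen1994HodgeAV, 4.14 and Lemma 5.2 (4)] -/
theorem nsc_minusTwo_weilSign :
    weilSign 3 (QuotientGroup.mk (Units.mk0 (-2 : ℚ) (by norm_num)) : weilNormResidueGroup 3) = (-1) ^ 3 := by
  rw [weilSign_mk_of_neg 3 (by simp only [Units.val_mk0]; norm_num)]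
  rfl

/-- **THE MEMBER of NSC(−2)** (P2-NSC-1 (i)): a complex abelian sixfold `(A, φ)` with `φ ≫ φ = −3`, a projective embedding `e` and a
rational `a ≠ 0` in `H²(ℙᴺ; ℂ)` such that the `K`-symmetrised hyperplane class `h_K = 3·e^*a + φ^*e^*a` has NON-DEGENERATE
discriminant class `[−2]`, together with a non-zero rational Weil class of Hodge type `(3,3)` — i.e. the premises of
`WeilClassesComponent 3 3 [−2]` are jointly satisfiable and the component is not a statement about the empty set. The witness of the
proof term is the CM tower `(E₀ × E₀)³`, `ψ₀ ≫ ψ₀ = −3`, `φ = (ψ₀ × (−ψ₀))³`, Segre weights `(2,1,1,1,1,1)` (module docstring).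
[cite: vanGeemen1994HodgeAV, 4.11, 4.14, Lemma 5.2 and 5.3–5.5] -/
theorem nsc_minusTwo_member :
    ∃ (A : AbelianVariety ℂ) (φ : A ⟶ A) (e : ProjectiveEmbedding A.X)
      (a : complexBetti (projectiveSpace e.n ℂ) 2) (c : complexBetti A.X (2 * 3)),
      A.dim = 2 * 3 ∧ IsSmoothProjective (2 * 3) A.X ∧ φ ≫ φ = -((3 : ℕ) • 𝟙 A) ∧ IsRationalClass a ∧ a ≠ 0 ∧
        HasWeilDiscriminantNondeg A φ 3 3
          (((3 : ℕ) : ℂ) • complexBetti.map e.ι 2 a + complexBetti.map φ.hom.hom.hom 2 (complexBetti.map e.ι 2 a))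
          (QuotientGroup.mk (Units.mk0 (-2 : ℚ) (by norm_num))) ∧
        c ∈ weilClassesOf A φ 3 3 ∧ IsRationalClass c ∧ IsOfHodgeType (2 * 3) A.X (2 * 3) 3 3 c ∧ c ≠ 0 :=
  weilClassesComponent_inhabited_of_weilSign_eq (by norm_num) (by norm_num) nsc_minusTwo_weilSign

/-- **The member in embedded form** (ring-2's `exists_member` at `(3, 3, [−2])` for a Segre-additive rational hyperplane family `g`):
a Weil-type pair `(A, φ)` of type `(3, 3)` with a projective embedding `e`, `1 ≤ e.n`, whose `K`-symmetrised hyperplane class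
`h_K = 3·e^*g + φ^*e^*g` has non-degenerate discriminant class `[−2]` and `h_K⁶ ≠ 0`. [cite: vanGeemen1994HodgeAV, 4.11, 4.14 and Lemma 5.2 (3)]
[cite: Hartshorne1977, II Ex. 5.11 and Ex. 5.12] -/
theorem nsc_minusTwo_member_weilType :
    ∃ (g : (N : ℕ) → complexBetti (projectiveSpace N ℂ) 2), (∀ N : ℕ, IsRationalClass (g N)) ∧ (∀ N : ℕ, 1 ≤ N → g N ≠ 0) ∧
      ∃ (A : AbelianVariety ℂ) (φ : A ⟶ A) (e : ProjectiveEmbedding A.X), IsWeilType A φ 3 3 ∧ 1 ≤ e.n ∧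
        HasWeilDiscriminantNondeg A φ 3 3
            (((3 : ℕ) : ℂ) • complexBetti.map e.ι 2 (g e.n) + complexBetti.map φ.hom.hom.hom 2 (complexBetti.map e.ι 2 (g e.n)))
            (QuotientGroup.mk (Units.mk0 (-2 : ℚ) (by norm_num))) ∧
        lefschetzPow (((3 : ℕ) : ℂ) • complexBetti.map e.ι 2 (g e.n) + complexBetti.map φ.hom.hom.hom 2 (complexBetti.map e.ι 2 (g e.n)))
            (2 * 3 - 1) 2
          (((3 : ℕ) : ℂ) • complexBetti.map e.ι 2 (g e.n) + complexBetti.map φ.hom.hom.hom 2 (complexBetti.map e.ι 2 (g e.n))) ≠ 0 := by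
  obtain ⟨g, hgr, hgnz, hgσ⟩ := exists_segreHyperplaneClasses
  obtain ⟨A, φ, e, hW, hen, hN, htop⟩ := exists_member g hgr hgnz hgσ (n := 3) (d := 3) (by norm_num) (by norm_num) nsc_minusTwo_weilSign
  exact ⟨g, hgr, hgnz, A, φ, e, hW, hen, hN, htop⟩

/-- **No polarized member of the class `[−2]` is hyperbolic** (NSC(−2) is a component of NON-SPLIT type): for an abelian sixfold `(A, φ)`,
`φ ≫ φ = −3`, a projective embedding `e` and a rational `a ≠ 0`, if `h_K = 3·e^*a + φ^*e^*a` has a non-degenerate discriminant witness of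
class `[−2]` then `(A, φ)` is NOT of hyperbolic Weil type for `h_K` — since `[−2] ≠ [(−1)³]` in `ℚˣ/Nm(ℚ(√−3)ˣ)` (`2` is not a norm,
ring-2 `negTwo_ne_splitDiscriminantClass`) and a hyperbolic `h_K` has class `[(−1)ⁿ]` (van Geemen (5.4.1), on the carriers).
[cite: vanGeemen1994HodgeAV, Lemma 5.2 (3) and 5.4 (5.4.1)] [cite: Markman2025SurveySecant, §11.5 Step 1] -/
theorem nsc_minusTwo_not_isHyperbolicWeilType {A : AbelianVariety ℂ} {φ : A ⟶ A} (hA : A.dim = 2 * 3)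
    (hφ : φ ≫ φ = -((3 : ℕ) • 𝟙 A)) (e : ProjectiveEmbedding A.X) {a : complexBetti (projectiveSpace e.n ℂ) 2}
    (ha : IsRationalClass a) (ha0 : a ≠ 0)
    (hδ : HasWeilDiscriminantNondeg A φ 3 3
      (((3 : ℕ) : ℂ) • complexBetti.map e.ι 2 a + complexBetti.map φ.hom.hom.hom 2 (complexBetti.map e.ι 2 a))
      (QuotientGroup.mk (Units.mk0 (-2 : ℚ) (by norm_num)))) :
    ¬ IsHyperbolicWeilType A φ 3
      (((3 : ℕ) : ℂ) • complexBetti.map e.ι 2 a + complexBetti.map φ.hom.hom.hom 2 (complexBetti.map e.ι 2 a)) :=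
  not_isHyperbolicWeilType_of_hasWeilDiscriminantNondeg_ne (by norm_num) hA (by norm_num) hφ e ha ha0 hδ
    negTwo_ne_splitDiscriminantClass

/-- **THE MEMBER, with its type**: the member of `nsc_minusTwo_member` is a polarized `ℚ(√−3)`-Weil sixfold of discriminant class `[−2]`
carrying a non-zero rational `(3,3)` Weil class and NOT hyperbolic for its polarization `h_K` — a point of the non-split component
NSC(−2) (the target `WeilClassesComponent 3 3 [−2]` quantifies over exactly such data). [cite: vanGeemen1994HodgeAV, 4.14, Lemma 5.2 and (5.4.1)] -/
theorem nsc_minusTwo_member_not_isHyperbolicWeilType :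
    ∃ (A : AbelianVariety ℂ) (φ : A ⟶ A) (e : ProjectiveEmbedding A.X)
      (a : complexBetti (projectiveSpace e.n ℂ) 2) (c : complexBetti A.X (2 * 3)),
      A.dim = 2 * 3 ∧ IsSmoothProjective (2 * 3) A.X ∧ φ ≫ φ = -((3 : ℕ) • 𝟙 A) ∧ IsRationalClass a ∧ a ≠ 0 ∧
        HasWeilDiscriminantNondeg A φ 3 3
          (((3 : ℕ) : ℂ) • complexBetti.map e.ι 2 a + complexBetti.map φ.hom.hom.hom 2 (complexBetti.map e.ι 2 a))
          (QuotientGroup.mk (Units.mk0 (-2 : ℚ) (by norm_num))) ∧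
        ¬ IsHyperbolicWeilType A φ 3
          (((3 : ℕ) : ℂ) • complexBetti.map e.ι 2 a + complexBetti.map φ.hom.hom.hom 2 (complexBetti.map e.ι 2 a)) ∧
        c ∈ weilClassesOf A φ 3 3 ∧ IsRationalClass c ∧ IsOfHodgeType (2 * 3) A.X (2 * 3) 3 3 c ∧ c ≠ 0 := by
  obtain ⟨A, φ, e, a, c, hA, hX, hφ, ha, ha0, hδ, hcW, hcQ, hcH, hc0⟩ := nsc_minusTwo_member
  exact ⟨A, φ, e, a, c, hA, hX, hφ, ha, ha0, hδ, nsc_minusTwo_not_isHyperbolicWeilType hA hφ e ha ha0 hδ, hcW, hcQ, hcH, hc0⟩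

end NscMemberMinusTwo

end Summit.HodgeConjecture.HodgeConjecture.WeilTypeLadder

end
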